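import Literature.Algebra.EuclideanLattices.RegevTwoPoint
import Literature.Computability.Complexity.CodeFPArith
import HarnessLib

/-!
# Regev 2004, Lemma 3.2: coefficient vectors as base-`2M` numbers, the DCP shift and its decoding

Topic `Algebra/EuclideanLattices` (family `pqc`); proved material towards the discharge of the
named fact `Literature.Algebra.EuclideanLattices.usvp_of_dihedralCoset` (O. Regev, *Quantum
computation and lattice problems*, SIAM J. Comput. 33 (2004) 738–760, Thm. 1.1). No named fact is
introduced; everything is proved.

Lemma 3.2 of the paper reduces the two-point problem to the dihedral coset problem: a register
`(|0, ā⟩ + |1, ā'⟩)/√2` with `ā, ā' ∈ A = {0, …, M−1}ⁿ` (`RegevTwoPoint.box n M`) and FIXED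
difference `ā' − ā = δ̄` is read through the injection `g(ā) = ∑ᵢ aᵢ (2M)^i` (p. 6: "the mapping
`(a₁, …, aₙ) ↦ a₁ + a₂ 2M + ⋯`"), and becomes the DCP register `(|0, x⟩ + |1, (x + d) mod N⟩)/√2`,
`N = (2M)ⁿ`, `x = g(ā)`, with the hidden shift `d = (∑ᵢ δᵢ (2M)^i) mod N` — the same `d` for every
register; conversely `δ̄` is read off `d` digit by digit once `|δᵢ| < M`. This file proves exactly
this arithmetic, for a general base `B ≥ M` where possible:

* `digitVal B e = ∑ᵢ eᵢ Bⁱ` (little-endian digits `e : Fin n → ℕ`): `digitVal_succ`, `digitVal_lt`,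
  the digit extraction `digitVal B e / Bⁱ % B = eᵢ` (`digitVal_div_pow_mod`) and, for `B = 2^w`,
  the BIT LAYOUT `(digitVal (2^w) e).testBit (w i + j) = (eᵢ).testBit j` (`testBit_digitVal_two_pow`,
  `testBit_digitVal_two_pow_of_le`) — writing the `w`-bit blocks of the `aᵢ` side by side on a
  register IS writing `g(ā)` in binary;
* `boxEnc B ā = g(ā)` for `ā ∈ box n M`, `dcpShift B n δ̄ = (∑ δᵢ Bⁱ) mod Bⁿ`, and the register
  identity **`boxEnc_add_eq_mod`**: `ā, ā + δ̄ ∈ box n M ⇒ g(ā + δ̄) = (g(ā) + dcpShift δ̄) mod Bⁿ`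
  (with `boxEnc_lt`, `dcpShift_lt`, `boxEnc_injOn`);
* the decoder `decodeShift B M n d = (digitᵢ((d + ∑ M Bⁱ) mod Bⁿ) − M)ᵢ` and
  **`decodeShift_dcpShift`**: `B = 2M`, `|δᵢ| < M ⇒ decodeShift (dcpShift δ̄) = δ̄`;
* **`decodeShiftFP`**: the decoder is polynomial time (typed `CodeFP`, `Computability/Complexity/
  CodeFPArith.lean`): `(1ⁿ, bin M, bin d) ↦` the raw list of the `n` integers `decodeShift (2M) M n d`.

## References

* O. Regev, *Quantum computation and lattice problems*, SIAM J. Comput. 33 (2004) 738–760,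
  Def. 2.1 (DCP), Lemma 3.2 (two-point ⇒ DCP: the map `g` and the shift), proof of Thm. 1.1
  (p. 7: reading `ū` off the DCP answer) [Regev2004].
* D. E. Knuth, *The Art of Computer Programming*, Vol. 2, 3rd ed., 1998, §4.1 (positional number
  systems). (Schoolbook; fully proved here.)
-/

noncomputable section

namespace Literature.Algebra.EuclideanLattices

namespace Regev2004

open Finset

variable {n : ℕ}

/-! ### Little-endian digit vectors -/

/-- The value of the little-endian digit vector `e` in base `B`: `∑ᵢ eᵢ Bⁱ`. [cite: KnuthTAOCP2, §4.1] -/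
def digitVal (B : ℕ) (e : Fin n → ℕ) : ℕ := ∑ i, e i * B ^ (i : ℕ)

/-- No digits. [folklore] -/
@[simp] theorem digitVal_zero (B : ℕ) (e : Fin 0 → ℕ) : digitVal B e = 0 := by simp [digitVal]

/-- Peeling the lowest digit: `digitVal B e = e₀ + B · digitVal B (tail e)`. [folklore] -/
theorem digitVal_succ (B : ℕ) (e : Fin (n + 1) → ℕ) : digitVal B e = e 0 + B * digitVal B (Fin.tail e) := by
  rw [digitVal, Fin.sum_univ_succ, digitVal, Finset.mul_sum]
  simp only [Fin.val_zero, pow_zero, mul_one, Fin.val_succ, Fin.tail]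
  congr 1
  exact Finset.sum_congr rfl fun i _ => by ring

/-- **Digit vectors with digits `< B` have value `< Bⁿ`.** [folklore] -/
theorem digitVal_lt {B : ℕ} : ∀ {n : ℕ} {e : Fin n → ℕ}, (∀ i, e i < B) → digitVal B e < B ^ n
  | 0, e, _ => by simp
  | n + 1, e, he => by
      rw [digitVal_succ, pow_succ']
      have h0 := he 0
      have ht : digitVal B (Fin.tail e) < B ^ n := digitVal_lt fun i => he i.succ
      have hB : 0 < B := lt_of_le_of_lt (Nat.zero_le _) h0
      calc e 0 + B * digitVal B (Fin.tail e) < B + B * digitVal B (Fin.tail e) := by omega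
        _ = B * (digitVal B (Fin.tail e) + 1) := by ring
        _ ≤ B * B ^ n := Nat.mul_le_mul_left _ ht

/-- **Digit extraction**: `digitVal B e / Bⁱ % B = eᵢ` for digits `< B`. [cite: KnuthTAOCP2, §4.1] -/
theorem digitVal_div_pow_mod {B : ℕ} : ∀ {n : ℕ} {e : Fin n → ℕ}, (∀ i, e i < B) → ∀ i : Fin n,
    digitVal B e / B ^ (i : ℕ) % B = e i
  | 0, _, _, i => i.elim0
  | n + 1, e, he, i => by
      have hB : 0 < B := lt_of_le_of_lt (Nat.zero_le _) (he 0)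
      rw [digitVal_succ]
      induction i using Fin.cases with
      | zero => rw [Fin.val_zero, pow_zero, Nat.div_one, Nat.add_mul_mod_self_left, Nat.mod_eq_of_lt (he 0)]
      | succ j =>
          rw [Fin.val_succ, pow_succ', ← Nat.div_div_eq_div_mul, Nat.add_mul_div_left _ _ hB,
            Nat.div_eq_of_lt (he 0), Nat.zero_add]
          exact digitVal_div_pow_mod (fun i => he i.succ) j

/-- **Block form**: dividing by `Bⁱ` leaves `eᵢ` as the lowest digit — `digitVal B e / Bⁱ = eᵢ + B r`
for some `r` (what the bit layout below needs). [folklore] -/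
theorem digitVal_div_pow_eq {B : ℕ} : ∀ {n : ℕ} {e : Fin n → ℕ}, (∀ i, e i < B) → ∀ i : Fin n,
    ∃ r : ℕ, digitVal B e / B ^ (i : ℕ) = e i + B * r
  | 0, _, _, i => i.elim0
  | n + 1, e, he, i => by
      have hB : 0 < B := lt_of_le_of_lt (Nat.zero_le _) (he 0)
      rw [digitVal_succ]
      induction i using Fin.cases with
      | zero => exact ⟨digitVal B (Fin.tail e), by rw [Fin.val_zero, pow_zero, Nat.div_one]⟩
      | succ j =>
          rw [Fin.val_succ, pow_succ', ← Nat.div_div_eq_div_mul, Nat.add_mul_div_left _ _ hB,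
            Nat.div_eq_of_lt (he 0), Nat.zero_add]
          exact digitVal_div_pow_eq (fun i => he i.succ) j

/-- **Bit layout in a power-of-two base**: bit `w i + j` (`j < w`) of `digitVal (2^w) e` is bit `j`
of `eᵢ` — the `w`-bit blocks of the digits, side by side. [folklore] -/
theorem testBit_digitVal_two_pow {w : ℕ} {e : Fin n → ℕ} (he : ∀ i, e i < 2 ^ w) (i : Fin n) {j : ℕ} (hj : j < w) :
    (digitVal (2 ^ w) e).testBit (w * i + j) = (e i).testBit j := by
  obtain ⟨r, hr⟩ := digitVal_div_pow_eq he i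
  have h1 : (digitVal (2 ^ w) e).testBit (w * i + j) = (digitVal (2 ^ w) e / (2 ^ w) ^ (i : ℕ)).testBit j := by
    rw [← pow_mul, Nat.testBit_div_two_pow, Nat.add_comm]
  rw [h1, hr, show e i + 2 ^ w * r = 2 ^ w * r + e i from Nat.add_comm _ _, Nat.testBit_two_pow_mul_add _ (he i),
    if_pos hj]

/-- Beyond the `n` blocks all bits vanish. [folklore] -/
theorem testBit_digitVal_two_pow_of_le {w : ℕ} {e : Fin n → ℕ} (he : ∀ i, e i < 2 ^ w) {k : ℕ} (hk : w * n ≤ k) :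
    (digitVal (2 ^ w) e).testBit k = false := by
  apply Nat.testBit_lt_two_pow
  calc digitVal (2 ^ w) e < (2 ^ w) ^ n := digitVal_lt he
    _ = 2 ^ (w * n) := by rw [← pow_mul]
    _ ≤ 2 ^ k := Nat.pow_le_pow_right (by norm_num) hk

/-- Digit vectors with digits `< B` are determined by their value. [folklore] -/
theorem digitVal_injective_of_lt {B : ℕ} {e e' : Fin n → ℕ} (he : ∀ i, e i < B) (he' : ∀ i, e' i < B)
    (h : digitVal B e = digitVal B e') : e = e' := by
  funext i
  rw [← digitVal_div_pow_mod he i, ← digitVal_div_pow_mod he' i, h]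

/-! ### The map `g` on the box and the DCP shift -/

/-- **Regev's injection `g(ā) = ∑ᵢ aᵢ Bⁱ`** on coefficient vectors with entries in `[0, B)`
(entries read through `Int.toNat`). [cite: Regev2004, Lemma 3.2 (proof: the mapping (a₁,…,aₙ) ↦ a₁ + a₂·2M + ⋯)] -/
def boxEnc (B : ℕ) (a : Fin n → ℤ) : ℕ := digitVal B fun i => (a i).toNat

/-- **The DCP shift of a difference vector**: `(∑ᵢ δᵢ Bⁱ) mod Bⁿ`. [cite: Regev2004, Lemma 3.2 (proof: the difference is fixed) and Def. 2.1] -/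
def dcpShift (B n : ℕ) (δ : Fin n → ℤ) : ℕ := ((∑ i, δ i * (B : ℤ) ^ (i : ℕ)) % ((B : ℤ) ^ n)).toNat

/-- `g(ā) < Bⁿ` on the box (`M ≤ B`). [folklore] -/
theorem boxEnc_lt {B M : ℕ} (hMB : M ≤ B) {a : Fin n → ℤ} (ha : a ∈ box n M) : boxEnc B a < B ^ n := by
  rw [mem_box_iff] at ha
  exact digitVal_lt fun i => by have := ha i; omega

/-- `g(ā)` as an integer is `∑ᵢ aᵢ Bⁱ` on vectors with nonnegative entries. [folklore] -/
theorem boxEnc_cast {B : ℕ} {a : Fin n → ℤ} (ha : ∀ i, 0 ≤ a i) : (boxEnc B a : ℤ) = ∑ i, a i * (B : ℤ) ^ (i : ℕ) := by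
  rw [boxEnc, digitVal, Nat.cast_sum]
  refine Finset.sum_congr rfl fun i _ => ?_
  rw [Nat.cast_mul, Nat.cast_pow, Int.toNat_of_nonneg (ha i)]

/-- The DCP shift is a residue modulo `Bⁿ`. [folklore] -/
theorem dcpShift_lt {B : ℕ} (hB : 0 < B) (n : ℕ) (δ : Fin n → ℤ) : dcpShift B n δ < B ^ n := by
  have hN : (0 : ℤ) < (B : ℤ) ^ n := by positivity
  have h := Int.emod_lt_of_pos (∑ i, δ i * (B : ℤ) ^ (i : ℕ)) hN
  have h0 := Int.emod_nonneg (∑ i, δ i * (B : ℤ) ^ (i : ℕ)) hN.ne'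
  rw [dcpShift]
  zify
  rw [Int.toNat_of_nonneg h0]
  exact_mod_cast h

/-- The DCP shift as an integer. [folklore] -/
theorem dcpShift_cast {B : ℕ} (hB : 0 < B) (n : ℕ) (δ : Fin n → ℤ) :
    (dcpShift B n δ : ℤ) = (∑ i, δ i * (B : ℤ) ^ (i : ℕ)) % ((B : ℤ) ^ n) := by
  have hN : (0 : ℤ) < (B : ℤ) ^ n := by positivity
  rw [dcpShift, Int.toNat_of_nonneg (Int.emod_nonneg _ hN.ne')]

/-- **The register identity of Lemma 3.2**: if `ā` and `ā + δ̄` both lie in the box then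
`g(ā + δ̄) = (g(ā) + d) mod Bⁿ` with the FIXED shift `d = dcpShift B n δ̄` — the two-point register
`(|0,ā⟩ + |1,ā + δ̄⟩)/√2` reads as the DCP register `(|0,x⟩ + |1,(x + d) mod N⟩)/√2`, `N = Bⁿ`.
[cite: Regev2004, Lemma 3.2 (proof)] -/
theorem boxEnc_add_eq_mod {B M : ℕ} (hMB : M ≤ B) {a δ : Fin n → ℤ} (ha : a ∈ box n M) (haδ : a + δ ∈ box n M) :
    boxEnc B (a + δ) = (boxEnc B a + dcpShift B n δ) % B ^ n := by
  rcases Nat.eq_zero_or_pos B with hB0 | hB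
  · -- `B = 0` forces `M = 0`: the box is empty unless `n = 0`
    subst hB0
    have hM : M = 0 := Nat.le_zero.1 hMB
    subst hM
    rcases Nat.eq_zero_or_pos n with hn | hn
    · subst hn; simp [boxEnc, dcpShift]
    · exfalso
      rw [mem_box_iff] at ha
      have := ha ⟨0, hn⟩
      omega
  have ha0 : ∀ i, 0 ≤ a i := fun i => ((mem_box_iff a).1 ha i).1
  have haδ0 : ∀ i, 0 ≤ (a + δ) i := fun i => ((mem_box_iff (a + δ)).1 haδ i).1
  have hlt : boxEnc B (a + δ) < B ^ n := boxEnc_lt hMB haδ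
  have hsum : (boxEnc B (a + δ) : ℤ) = ∑ i, a i * (B : ℤ) ^ (i : ℕ) + ∑ i, δ i * (B : ℤ) ^ (i : ℕ) := by
    rw [boxEnc_cast haδ0, ← Finset.sum_add_distrib]
    exact Finset.sum_congr rfl fun i _ => by simp only [Pi.add_apply]; ring
  apply Int.natCast_inj.1
  rw [Int.natCast_mod, Nat.cast_add, boxEnc_cast ha0, dcpShift_cast hB, Nat.cast_pow, Int.add_emod_emod, ← hsum]
  symm
  apply Int.emod_eq_of_lt (by positivity)
  exact_mod_cast hlt

/-- `g` is injective on the box (`M ≤ B`). [cite: Regev2004, Lemma 3.2 (proof: "injectively map")] -/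
theorem boxEnc_injOn {B M : ℕ} (hMB : M ≤ B) : Set.InjOn (boxEnc (n := n) B) (box n M : Set (Fin n → ℤ)) := by
  intro a ha a' ha' h
  rw [Finset.mem_coe, mem_box_iff] at ha ha'
  have he : ∀ i, (a i).toNat < B := fun i => by have := ha i; omega
  have he' : ∀ i, (a' i).toNat < B := fun i => by have := ha' i; omega
  have := digitVal_injective_of_lt he he' h
  funext i
  have hi : (a i).toNat = (a' i).toNat := congrFun this i
  have h1 := (ha i).1
  have h2 := (ha' i).1
  omega

/-! ### Decoding the hidden difference from the DCP answer -/

/-- The offset `∑ᵢ M Bⁱ` that makes all digits of `d + offset` nonnegative. [folklore] -/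
def shiftOffset (B M n : ℕ) : ℕ := digitVal B fun _ : Fin n => M

/-- **The decoder**: digit `i` of `(d + ∑ M Bⁱ) mod Bⁿ`, minus `M`.
[cite: Regev2004, Thm. 1.1 (proof, p. 7: the DCP answer determines the uᵢ)] -/
def decodeShift (B M n : ℕ) (d : ℕ) : Fin n → ℤ := fun i =>
  (((d + shiftOffset B M n) % B ^ n / B ^ (i : ℕ) % B : ℕ) : ℤ) - M

/-- **Decoding is correct**: with `B = 2M` and `|δᵢ| < M` for all `i`, the decoder recovers `δ̄`
from its DCP shift. [cite: Regev2004, Lemma 3.2 and Thm. 1.1 (proof, p. 7)] -/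
theorem decodeShift_dcpShift {M : ℕ} {δ : Fin n → ℤ} (hδ : ∀ i, (δ i).natAbs < M) :
    decodeShift (2 * M) M n (dcpShift (2 * M) n δ) = δ := by
  rcases Nat.eq_zero_or_pos n with hn | hn
  · subst hn; funext i; exact i.elim0
  have hM : 0 < M := by have := hδ ⟨0, hn⟩; omega
  set B := 2 * M with hB
  have hB0 : 0 < B := by omega
  -- the digits of `D + offset`
  set e : Fin n → ℕ := fun i => (δ i + M).toNat with he
  have he_lt : ∀ i, e i < B := fun i => by have := hδ i; simp only [he]; omega
  have he_cast : ∀ i, (e i : ℤ) = δ i + M := fun i => by have := hδ i; simp only [he]; omega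
  have hval : (digitVal B e : ℤ) = (∑ i, δ i * (B : ℤ) ^ (i : ℕ)) + (shiftOffset B M n : ℤ) := by
    rw [shiftOffset, digitVal, digitVal, Nat.cast_sum, Nat.cast_sum, ← Finset.sum_add_distrib]
    refine Finset.sum_congr rfl fun i _ => ?_
    push_cast
    rw [he_cast]
    ring
  have hvlt : digitVal B e < B ^ n := digitVal_lt he_lt
  have hmod : (dcpShift B n δ + shiftOffset B M n) % B ^ n = digitVal B e := by
    apply Int.natCast_inj.1
    rw [Int.natCast_mod, Nat.cast_add, dcpShift_cast hB0, Nat.cast_pow, Int.emod_add_emod, ← hval]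
    apply Int.emod_eq_of_lt (by positivity)
    exact_mod_cast hvlt
  funext i
  rw [decodeShift, hmod, digitVal_div_pow_mod he_lt i, he_cast]
  ring

/-! ### The decoder on codes -/

/-- The offset in closed form: `∑_{i<n} M Bⁱ = M (Bⁿ − 1)/(B − 1)` for `B ≥ 2`, and `0` for `M = 0`,
`B = 2M`. [folklore] -/
theorem shiftOffset_two_mul (M n : ℕ) : shiftOffset (2 * M) M n = M * (((2 * M) ^ n - 1) / (2 * M - 1)) := by
  rcases Nat.eq_zero_or_pos M with rfl | hM
  · simp [shiftOffset, digitVal]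
  · rw [shiftOffset, digitVal, ← Finset.mul_sum, Fin.sum_univ_eq_sum_range (fun i => (2 * M) ^ i) n,
      Nat.geomSum_eq (by omega)]

/-- `List.ofFn` over `Fin n` of a function of the index is a map over `range n`. [folklore] -/
theorem ofFn_eq_map_range' {α : Type} (f : ℕ → α) (n : ℕ) : (List.ofFn fun i : Fin n => f i) = (List.range n).map f := by
  apply List.ext_getElem (by simp)
  intro i h₁ h₂
  simp

open _root_.Computability Literature.Computability.Complexity Literature.Computability.Complexity.CodeFP in
/-- **The decoder is polynomial time**: `(1ⁿ, bin M, bin d) ↦ decodeShift (2M) M n d` as the raw list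
of its `n` integers (typed `CodeFP`: powers by unary exponents below `n`, one division with remainder
per digit). [cite: Regev2004, Thm. 1.1 (proof, p. 7) and Lemma 3.2; AroraBarak2009, §1.3] -/
theorem decodeShiftFP : CodeFP (pairE unE (pairE natE natE)) (rawE intE)
    (fun p => List.ofFn (decodeShift (2 * p.2.1) p.2.1 p.1 p.2.2)) := by
  let aE : ℕ × (ℕ × ℕ) → List Bool := pairE unE (pairE natE natE)
  have hn : CodeFP aE unE (fun p => p.1) := fst _ _
  have hM : CodeFP aE natE (fun p => p.2.1) := (snd _ _).fst'
  have hd : CodeFP aE natE (fun p => p.2.2) := (snd _ _).snd'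
  have hB : CodeFP aE natE (fun p => 2 * p.2.1) := (natMul.comp ((const _ 2).pair hM) :)
  have hBn : CodeFP aE natE (fun p => (2 * p.2.1) ^ p.1) := (natPow.comp (hB.pair hn) :)
  have hoff : CodeFP aE natE (fun p => p.2.1 * (((2 * p.2.1) ^ p.1 - 1) / (2 * p.2.1 - 1))) :=
    (natMul.comp (hM.pair (natDiv.comp ((natSub.comp (hBn.pair (const _ 1))).pair (natSub.comp (hB.pair (const _ 1)))))) :)
  have hV : CodeFP aE natE (fun p => (p.2.2 + p.2.1 * (((2 * p.2.1) ^ p.1 - 1) / (2 * p.2.1 - 1))) % (2 * p.2.1) ^ p.1) :=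
    (natMod.comp ((natAdd.comp (hd.pair hoff)).pair hBn) :)
  -- the context of the digit map: `(V, (B, (M, 1ⁿ)))`, item `i`
  let cE : ℕ × (ℕ × (ℕ × ℕ)) → List Bool := pairE natE (pairE natE (pairE natE unE))
  have hctx : CodeFP aE cE (fun p => ((p.2.2 + p.2.1 * (((2 * p.2.1) ^ p.1 - 1) / (2 * p.2.1 - 1))) % (2 * p.2.1) ^ p.1,
      (2 * p.2.1, (p.2.1, p.1)))) := hV.pair (hB.pair (hM.pair hn))
  have hi : CodeFP (pairE cE natE) unE (fun t => min t.2 t.1.2.2.2) := (unOfNatMin.comp ((fst _ _).snd'.snd'.snd'.pair (snd _ _)) :)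
  have hBi : CodeFP (pairE cE natE) natE (fun t => t.1.2.1 ^ min t.2 t.1.2.2.2) := (natPow.comp ((fst _ _).snd'.fst'.pair hi) :)
  have hdig : CodeFP (pairE cE natE) natE (fun t => t.1.1 / t.1.2.1 ^ min t.2 t.1.2.2.2 % t.1.2.1) :=
    (natMod.comp ((natDiv.comp ((fst _ _).fst'.pair hBi)).pair (fst _ _).snd'.fst') :)
  have hitem : CodeFP (pairE cE natE) intE (fun t => ((t.1.1 / t.1.2.1 ^ min t.2 t.1.2.2.2 % t.1.2.1 : ℕ) : ℤ) - (t.1.2.2.1 : ℤ)) :=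
    (intSub.comp ((intOfNat.comp hdig).pair (intOfNat.comp (fst _ _).snd'.snd'.fst')) :)
  have hrange : CodeFP aE (rawE natE) (fun p => List.range p.1) := urange.comp hn
  refine (((map hitem).comp (hctx.pair hrange)).congr fun p => ?_)
  obtain ⟨n, M, d⟩ := p
  have e : List.ofFn (decodeShift (2 * M) M n d) = (List.range n).map fun i =>
      (((d + shiftOffset (2 * M) M n) % (2 * M) ^ n / (2 * M) ^ i % (2 * M) : ℕ) : ℤ) - (M : ℤ) :=
    ofFn_eq_map_range' (fun i => (((d + shiftOffset (2 * M) M n) % (2 * M) ^ n / (2 * M) ^ i % (2 * M) : ℕ) : ℤ) - (M : ℤ)) n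
  simp only
  rw [e]
  refine List.map_congr_left fun i hi => ?_
  rw [List.mem_range] at hi
  rw [min_eq_left hi.le, shiftOffset_two_mul]

open Literature.Computability.Complexity Literature.Computability.Complexity.CodeFP in
/-- **The decoder, unpacked**: an `FP` string function mapping `⟨1ⁿ, ⟨bin M, bin d⟩⟩` to the raw list
code of `decodeShift (2M) M n d`. [cite: Regev2004, Thm. 1.1 (proof, p. 7)] -/
theorem exists_fp_decodeShift : ∃ f ∈ FP, ∀ n M d : ℕ,
    f (boolPair (unE n) (boolPair (natE M) (natE d))) = rawE intE (List.ofFn (decodeShift (2 * M) M n d)) := by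
  obtain ⟨f, hf, h⟩ := decodeShiftFP
  exact ⟨f, hf, fun n M d => h (n, (M, d))⟩

end Regev2004

end Literature.Algebra.EuclideanLattices
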